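import Summits.ABC.ABC.Theorems.ManyPrimeValuationProduct.Negative.JlScaling

/-!
# Negative lemma for line `jl-zero-cycle-height` (crux stmt-ABC-1561, `ManyPrimeValuationProduct`),
stub 5 of rev a1: the reverse-Jensen DEFECT is scale-free — what the period condition can and
cannot do in `stub_defectBound`

`DefectBound` (skeleton `Cruxes/ManyPrimeValuationProduct/Lines/jl_zero_cycle_height.lean`, rev a1)
asks, for every admissible Shimura datum `(S, F)` and every non-zero weight-2 form `s` on `S.Gamma`
WITH PERIODS IN THE NÉRON LATTICE, `Def_F(s) := log((vol F)⁻¹ ∫_F ‖s‖²_pt) − (vol F)⁻¹ ∫_F log ‖s‖²_pt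
≤ ε log N + C`, `‖s‖²_pt(z) = |s(z)|² (Im z)²` (the skeleton's `pet s z`, written out here as in
`Negative/JlScaling.lean`).  This file records, sorry-free (drefute seat
`refuter-drefute-stmt-ABC-1561-g3-0`, 2026-08-16):

* `log_mean_pet_smul`, `defect_smul`: `Def_F(c • s) = Def_F(s)` for every real `c > 0` — the defect is
  a function of the LINE `ℝ • s` only.  Contrast `JlScaling.not_exists_uniform_mean_log_lower_bound`:
  in the lever `stub_zeroCycleHeight` the period condition is load-bearing through the normalisation;
  in `stub_defectBound` it cannot act through the normalisation at all.
* `defect_le_of_smul_mem`: consequently, if the defect is bounded by `B` on the non-zero forms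
  satisfying a condition `P` (e.g. `P s = HasPeriodsIn Γ s Λ_E`), it is bounded by the same `B` on
  every non-zero form some positive multiple of which satisfies `P` — for the period condition:
  periods in `(1/n) Λ_E`, i.e. in `ℚ Λ_E`.  Integrality data (Manin constant, `c_f`, Česnavičius) are
  therefore INVISIBLE to `stub_defectBound`; only the direction of `s` in `S₂(Γ)` — the isogeny
  class / Hecke eigen-direction cut out by `Hom(J, E) ⊗ ℚ` — can carry its content.  Any proof must
  use that `s` is (a rational combination of pull-backs of) the Jacquet–Langlands NEWFORM, not merely
  a holomorphic differential: for a general non-zero `s ∈ S₂(Γ)` Riemann–Roch gives forms with a zero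
  of order `≥ g − 1` at any prescribed point, whose defect (the Green-energy `log mean_μ exp Σ_i
  G(·, z_i)` of a half-clustered zero divisor) is heuristically `≍ (vol/λ₁)^{1/2} ≫ log N`.
-/

set_option linter.dupNamespace false

noncomputable section

open MeasureTheory
open scoped MatrixGroups

namespace Summit.ABC.ABC.Theorems.ManyPrimeValuationProduct.Negative.JlScaling

variable {Γ : Subgroup (GL (Fin 2) ℝ)} {F : Set UpperHalfPlane}

/-- The mean square scales by `c²`: `∫_F ‖c • s‖²_pt = c² ∫_F ‖s‖²_pt`. [folklore] -/
theorem setIntegral_pet_smul (s : CuspForm Γ 2) (c : ℝ) :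
    ∫ z in F, ‖(c • s) z‖ ^ 2 * z.im ^ 2 = c ^ 2 * ∫ z in F, ‖s z‖ ^ 2 * z.im ^ 2 := by
  simp_rw [pet_smul]
  exact integral_const_mul _ _

/-- `log` of the mean square scales by `2 log c` (`c > 0`, `0 < vol F < ∞`, `∫_F ‖s‖²_pt > 0`).
[folklore] -/
theorem log_mean_pet_smul (hF0 : volume F ≠ 0) (hFtop : volume F ≠ ⊤) (s : CuspForm Γ 2)
    (hI : 0 < ∫ z in F, ‖s z‖ ^ 2 * z.im ^ 2) {c : ℝ} (hc : 0 < c) :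
    Real.log ((volume F).toReal⁻¹ * ∫ z in F, ‖(c • s) z‖ ^ 2 * z.im ^ 2) =
      2 * Real.log c + Real.log ((volume F).toReal⁻¹ * ∫ z in F, ‖s z‖ ^ 2 * z.im ^ 2) := by
  have hV : 0 < (volume F).toReal := ENNReal.toReal_pos hF0 hFtop
  have hVI : 0 < (volume F).toReal⁻¹ * ∫ z in F, ‖s z‖ ^ 2 * z.im ^ 2 :=
    mul_pos (inv_pos.mpr hV) hI
  rw [setIntegral_pet_smul, mul_left_comm, Real.log_mul (pow_ne_zero 2 hc.ne') hVI.ne',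
    Real.log_pow]
  push_cast
  ring

/-- **The reverse-Jensen defect is scale-free**: `Def_F(c • s) = Def_F(s)` for `c > 0`. [folklore] -/
theorem defect_smul (hF0 : volume F ≠ 0) (hFtop : volume F ≠ ⊤) (s : CuspForm Γ 2)
    (hint : IntegrableOn (fun z => Real.log (‖s z‖ ^ 2 * z.im ^ 2)) F)
    (hpos : ∀ᵐ z ∂(volume.restrict F), 0 < ‖s z‖ ^ 2 * z.im ^ 2)
    (hI : 0 < ∫ z in F, ‖s z‖ ^ 2 * z.im ^ 2) {c : ℝ} (hc : 0 < c) :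
    Real.log ((volume F).toReal⁻¹ * ∫ z in F, ‖(c • s) z‖ ^ 2 * z.im ^ 2) -
        (volume F).toReal⁻¹ * ∫ z in F, Real.log (‖(c • s) z‖ ^ 2 * z.im ^ 2) =
      Real.log ((volume F).toReal⁻¹ * ∫ z in F, ‖s z‖ ^ 2 * z.im ^ 2) -
        (volume F).toReal⁻¹ * ∫ z in F, Real.log (‖s z‖ ^ 2 * z.im ^ 2) := by
  obtain ⟨-, hmean⟩ := mean_log_pet_smul hF0 hFtop s hint hpos hc
  rw [hmean, log_mean_pet_smul hF0 hFtop s hI hc]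
  ring

/-- The side conditions of `DefectBound` are inherited by positive multiples. [folklore] -/
theorem side_conditions_smul (hF0 : volume F ≠ 0) (hFtop : volume F ≠ ⊤) (s : CuspForm Γ 2)
    (hint : IntegrableOn (fun z => Real.log (‖s z‖ ^ 2 * z.im ^ 2)) F)
    (hint₂ : IntegrableOn (fun z => ‖s z‖ ^ 2 * z.im ^ 2) F)
    (hpos : ∀ᵐ z ∂(volume.restrict F), 0 < ‖s z‖ ^ 2 * z.im ^ 2)
    (hI : 0 < ∫ z in F, ‖s z‖ ^ 2 * z.im ^ 2) {c : ℝ} (hc : 0 < c) :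
    c • s ≠ 0 ∧ IntegrableOn (fun z => Real.log (‖(c • s) z‖ ^ 2 * z.im ^ 2)) F ∧
      IntegrableOn (fun z => ‖(c • s) z‖ ^ 2 * z.im ^ 2) F ∧
      (∀ᵐ z ∂(volume.restrict F), 0 < ‖(c • s) z‖ ^ 2 * z.im ^ 2) ∧
      0 < ∫ z in F, ‖(c • s) z‖ ^ 2 * z.im ^ 2 := by
  obtain ⟨hint', -⟩ := mean_log_pet_smul hF0 hFtop s hint hpos hc
  refine ⟨smul_ne_zero_of_ae_pos hF0 s hpos hc.ne', hint', ?_, ?_, ?_⟩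
  · have e : (fun z : UpperHalfPlane => ‖(c • s) z‖ ^ 2 * z.im ^ 2) =
        fun z => c ^ 2 * (‖s z‖ ^ 2 * z.im ^ 2) := funext (pet_smul c s)
    rw [e]
    exact hint₂.const_mul (c ^ 2)
  · filter_upwards [hpos] with z hz
    rw [pet_smul]; positivity
  · rw [setIntegral_pet_smul]; positivity

/-- **What the period condition can do in `stub_defectBound`.**  If the defect is `≤ B` on every
non-zero form satisfying a condition `P` (with the stub's side conditions), then it is `≤ B` on every
non-zero form `s` such that SOME positive multiple `c • s` satisfies `P`.  For
`P = HasPeriodsIn Γ · Λ_E`: the Néron lattice may be replaced by `(1/n) Λ_E` for any `n`, i.e. by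
`ℚ Λ_E` — the stub constrains the direction of `s` only. [folklore] -/
theorem defect_le_of_smul_mem (hF0 : volume F ≠ 0) (hFtop : volume F ≠ ⊤) {B : ℝ}
    (P : CuspForm Γ 2 → Prop)
    (h : ∀ s : CuspForm Γ 2, s ≠ 0 → P s →
      IntegrableOn (fun z => Real.log (‖s z‖ ^ 2 * z.im ^ 2)) F →
      IntegrableOn (fun z => ‖s z‖ ^ 2 * z.im ^ 2) F →
      (∀ᵐ z ∂(volume.restrict F), 0 < ‖s z‖ ^ 2 * z.im ^ 2) →
      (0 < ∫ z in F, ‖s z‖ ^ 2 * z.im ^ 2) →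
        Real.log ((volume F).toReal⁻¹ * ∫ z in F, ‖s z‖ ^ 2 * z.im ^ 2) -
          (volume F).toReal⁻¹ * ∫ z in F, Real.log (‖s z‖ ^ 2 * z.im ^ 2) ≤ B)
    (s : CuspForm Γ 2) {c : ℝ} (hc : 0 < c) (hP : P (c • s))
    (hint : IntegrableOn (fun z => Real.log (‖s z‖ ^ 2 * z.im ^ 2)) F)
    (hint₂ : IntegrableOn (fun z => ‖s z‖ ^ 2 * z.im ^ 2) F)
    (hpos : ∀ᵐ z ∂(volume.restrict F), 0 < ‖s z‖ ^ 2 * z.im ^ 2)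
    (hI : 0 < ∫ z in F, ‖s z‖ ^ 2 * z.im ^ 2) :
    Real.log ((volume F).toReal⁻¹ * ∫ z in F, ‖s z‖ ^ 2 * z.im ^ 2) -
        (volume F).toReal⁻¹ * ∫ z in F, Real.log (‖s z‖ ^ 2 * z.im ^ 2) ≤ B := by
  obtain ⟨hne, hint', hint₂', hpos', hI'⟩ := side_conditions_smul hF0 hFtop s hint hint₂ hpos hI hc
  have hB := h (c • s) hne hP hint' hint₂' hpos' hI'
  rwa [defect_smul hF0 hFtop s hint hpos hI hc] at hB

end Summit.ABC.ABC.Theorems.ManyPrimeValuationProduct.Negative.JlScaling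

end
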